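import Literature.MathematicalPhysics.QuantumManyBody.TorusBoseFockLayer
import Mathlib.RingTheory.MvPolynomial.Homogeneous
import Mathlib.RingTheory.MvPolynomial.EulerIdentity
import Mathlib.MeasureTheory.Integral.Bochner.ContinuousLinearMap
import Mathlib.MeasureTheory.Integral.Pi
import HarnessLib

/-!
# The sector dictionary on the torus: a finite-mode Fock sector `A = ∑_d a_d (a†)^d|0⟩` as an
# `n`-body trigonometric polynomial `Ψ_A`, with `‖Ψ_A‖² = L^{3n}⟨A,A⟩`, `⟨Ψ_A, -ΔΨ_A⟩ = L^{3n}⟨A, dΓ(-Δ)A⟩`,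
# and the variational bound `E^per(n,L) ≤ ⟨A, dΓ(-Δ)A⟩/⟨A,A⟩ + (interaction of Ψ_A)/‖Ψ_A‖²`

Topic `Literature/MathematicalPhysics/QuantumManyBody`, companion of `TorusBoseFockLayer.lean`
(layer A: the holomorphic Fock model `MvPolynomial ι ℂ`, `a†_p = X_p`, `a_p = ∂_p`, `fockInner`;
layer B/C: plane waves `cellWave`, `waveVector`, the torus of side `L`) and of
`BogoliubovWeylCalculus.lean` (provefact
`Literature.MathematicalPhysics.QuantumManyBody.BoseGas.BastiCenatiempoSchlein2021_upperBound`,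
Prop. 1.3: the trial state is built and its energy computed in second quantisation, but the target
`periodicGroundStateEnergy v n L` is an infimum over first-quantised `PeriodicTrialState`s). This
file is the bridge (A.9)–(A.10) of [LSSY2005, App. A] **from Fock space to configuration space**,
for a finite set of modes `ι` with injective momentum labels `e : ι → ℤ³`:

* `Fock.wordOcc`, `Fock.amp` — the occupation configuration `d(k)` of a word `k ∈ ιⁿ` and the
  symmetric amplitude `ψ̃_A(k) = (n!)^{-1/2} d(k)! a_{d(k)}` of a sector `A = ∑ a_dX^d`
  ((A.9): `(a†)^d|0⟩ = (n!)^{-1/2}∑_π ⊗φ_{p_π(i)}`); the annihilation recursion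
  `ψ̃_A(p::k) = (n+1)^{-1/2}ψ̃_{∂_pA}(k)` (`amp_cons`, (A.13)) and the **isometry**
  `∑_k conj ψ̃_A(k) ψ̃_B(k) = ⟨A,B⟩` (`sum_conj_amp_mul_amp`, by induction on `n` through the
  polarised Euler identity `∑_p⟨∂_pA,∂_pB⟩ = n⟨A,B⟩` — no word counting);
* `sectorWave L e A n X = ∑_k ψ̃_A(k) ∏ᵢ e_{e(kᵢ)}(xᵢ)` — smooth, `Lℤ³`-periodic in each particle,
  Bose-symmetric (`contDiff_sectorWave`, `sectorWave_periodic`, `sectorWave_comp_perm`);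
* **orthogonality on `Λⁿ`** `∫_{Λⁿ}∏ᵢe_{mᵢ}(xᵢ) = [m=0]L^{3n}` (`integral_cellN_prod_cellWave`, Fubini
  via `MeasureTheory.integral_fin_nat_prod_eq_prod`) and hence
  `∫_{Λⁿ} conj Ψ_A Ψ_B = L^{3n}⟨A,B⟩`, `∫_{Λⁿ}|Ψ_A|² = L^{3n}‖A‖²`
  (`integral_cellN_conj_sectorWave_mul_sectorWave`, `integral_cellN_norm_sq_sectorWave`);
* **kinetic energy** `∂_{xᵢ,j}Ψ_A = ∑_k ψ̃_A(k)(2πi e(kᵢ)ⱼ/L)∏e` (`fderiv_sectorWave_single`) and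
  `∫_{Λⁿ}∑ᵢ|∇ᵢΨ_A|² = L^{3n}∑_p|2πe(p)/L|²‖∂_pA‖²` = `L^{3n}⟨A, ∑_p ε(p)a†_pa_pA⟩`
  (`integral_cellN_kinetic_sectorWave`; the one-body sum `∑ᵢw(kᵢ)` becomes `∑_pw_pa†_pa_p` by Bose
  symmetry and the annihilation recursion, `sum_sum_norm_sq_amp_mul_weight`);
* `sectorTrialState` — `Ψ_A/‖Ψ_A‖` as a `PeriodicTrialState n L` for `A ≠ 0`, and the
  **variational bound** `periodicGroundStateEnergy_le_sector`:
  `E^per(n,L) ≤ ∑_p|2πe(p)/L|²‖∂_pA‖²/‖A‖² + (L^{3n}‖A‖²)⁻¹∫_{Λⁿ}(∑_{i<j}v^per(xᵢ-xⱼ))|Ψ_A|²`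
  (interaction left in configuration space; its second-quantised form (A.10) is for the sequel).

## References

* [LSSY2005] E. H. Lieb, R. Seiringer, J. P. Solovej, J. Yngvason, *The Mathematics of the Bose Gas
  and its Condensation* (2005), App. A: (A.5) (momentum representation), (A.6) (`ε(p) = p²`),
  (A.9) (the isomorphism `φ ↦ ∑φ a†⋯a†|0⟩`), (A.10) (`H` in second quantisation), (A.13)
  (`a(f)` on `N`-body functions).
* [BastiCenatiempoSchlein2021] G. Basti, S. Cenatiempo, B. Schlein, Forum Math. Sigma 9 (2021) e74,
  §2 before (2.1) (`𝓕(Λ) = ⊕ L²_s(Λⁿ)`, `(ℋ_NΨ)^{(n)} = ℋ_N^{(n)}Ψ^{(n)}`).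
* Tree: `TorusBoseFockLayer.lean`, `PeriodicBoseGasFourier.lean` (`cellWave`, `conj_cellWave`,
  `cellWave_add_index`, `fderiv_cellWave_apply_single`, `cellWave_periodic`,
  `integral_cell_cellWave_eq_zero`), `PeriodicBoseGasThm31.lean` (`volume_restrict_cellN`).
-/

noncomputable section

namespace Literature.MathematicalPhysics.QuantumManyBody.BoseGas

open Complex MvPolynomial Finset MeasureTheory
open scoped ComplexConjugate BigOperators ENNReal NNReal

namespace Fock

variable {ι : Type*}

/-! ### Words, their occupation configurations, and the symmetric amplitude of a sector -/

/-- The **occupation configuration** `d(k) = ∑ᵢ e_{kᵢ}` of a word `k = (k₁,…,k_n)` of modes (the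
multiset of the word as a finitely supported function). [cite: LSSY2005, App. A (A.9)] -/
def wordOcc {n : ℕ} (k : Fin n → ι) : ι →₀ ℕ := ∑ i, Finsupp.single (k i) 1

/-- The **symmetric momentum amplitude** of the `n`-particle sector `A = ∑_d a_d X^d`:
`ψ̃_A(k₁,…,k_n) = (n!)^{-1/2} · d(k)! · a_{d(k)}`, i.e. the coefficient of the ordered product state
`φ_{k₁} ⊗ ⋯ ⊗ φ_{k_n}` in `∑_d a_d (a†)^d|0⟩` ((A.9): `(a†)^d|0⟩ = (n!)^{-1/2} ∑_π ⊗ᵢ φ_{p_{π(i)}}`,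
and each ordered word of configuration `d` arises from `d!` permutations `π`).
[cite: LSSY2005, App. A (A.9)] -/
def amp (A : MvPolynomial ι ℂ) (n : ℕ) (k : Fin n → ι) : ℂ :=
  (((Real.sqrt (n.factorial : ℝ))⁻¹ : ℝ) : ℂ) * (occFactorial (wordOcc k) : ℂ) * coeff (wordOcc k) A

section Words

/-- The empty word has configuration `0`. [folklore] -/
theorem wordOcc_zero (k : Fin 0 → ι) : wordOcc k = 0 := by
  simp [wordOcc]

/-- **`d(p :: k) = e_p + d(k)`.** [folklore] -/
theorem wordOcc_cons {n : ℕ} (p : ι) (k : Fin n → ι) :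
    wordOcc (Fin.cons p k : Fin (n + 1) → ι) = Finsupp.single p 1 + wordOcc k := by
  simp [wordOcc, Fin.sum_univ_succ]

/-- The configuration of a word of length `n` has degree `n`. [folklore] -/
theorem degree_wordOcc {n : ℕ} (k : Fin n → ι) : (wordOcc k).degree = n := by
  simp [wordOcc, map_sum]

/-- The configuration of a word is invariant under permutations of the letters. [folklore] -/
theorem wordOcc_comp_perm {n : ℕ} (k : Fin n → ι) (τ : Equiv.Perm (Fin n)) :
    wordOcc (k ∘ τ) = wordOcc k := by
  simp only [wordOcc, Function.comp]
  exact Equiv.sum_comp τ (fun i => Finsupp.single (k i) 1)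

/-- The amplitude is a symmetric function of the word. [cite: LSSY2005, App. A (A.9)] -/
theorem amp_comp_perm (A : MvPolynomial ι ℂ) {n : ℕ} (k : Fin n → ι) (τ : Equiv.Perm (Fin n)) :
    amp A n (k ∘ τ) = amp A n k := by
  simp only [amp, wordOcc_comp_perm]

/-- The amplitude of the empty word is the constant coefficient. [folklore] -/
theorem amp_zero_word (A : MvPolynomial ι ℂ) (k : Fin 0 → ι) : amp A 0 k = coeff 0 A := by
  simp [amp, wordOcc_zero, occFactorial]

/-- The amplitude is additive in the sector. [folklore] -/
theorem amp_add (A B : MvPolynomial ι ℂ) (n : ℕ) (k : Fin n → ι) :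
    amp (A + B) n k = amp A n k + amp B n k := by
  simp only [amp, coeff_add, mul_add]

/-- The amplitude is homogeneous in the sector. [folklore] -/
theorem amp_smul (c : ℂ) (A : MvPolynomial ι ℂ) (n : ℕ) (k : Fin n → ι) :
    amp (c • A) n k = c * amp A n k := by
  simp only [amp, coeff_smul, smul_eq_mul]; ring

/-- **The annihilation recursion of the amplitude**:
`ψ̃_A(p, k₂, …, k_{n+1}) = (n+1)^{-1/2} ψ̃_{a_pA}(k₂, …, k_{n+1})` — the first-quantised action
`(a_pΨ)(k') = √(n+1) Ψ(p, k')` of `a_p = ∂_p` [LSSY2005, (A.13)] read backwards.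
[cite: LSSY2005, App. A (A.13)] -/
theorem amp_cons [DecidableEq ι] (A : MvPolynomial ι ℂ) {n : ℕ} (p : ι) (k : Fin n → ι) :
    amp A (n + 1) (Fin.cons p k) =
      (((Real.sqrt ((n : ℝ) + 1))⁻¹ : ℝ) : ℂ) * amp (pderiv p A) n k := by
  simp only [amp, wordOcc_cons, coeff_pderiv]
  rw [add_comm (Finsupp.single p 1) (wordOcc k), occFactorial_add_single]
  have hfac : ((n + 1).factorial : ℝ) = ((n : ℝ) + 1) * n.factorial := by
    rw [Nat.factorial_succ]; push_cast; ring
  have hsqrt : Real.sqrt (((n + 1).factorial : ℝ)) = Real.sqrt ((n : ℝ) + 1) * Real.sqrt (n.factorial : ℝ) := by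
    rw [hfac, Real.sqrt_mul (by positivity)]
  rw [hsqrt, mul_inv]
  push_cast
  ring

/-- **The polarised Euler identity**: `∑_p ⟨∂_pA, ∂_pB⟩ = m ⟨A, B⟩` for `A` homogeneous of
degree `m`. [folklore] -/
theorem sum_fockInner_pderiv_pderiv [Fintype ι] {A : MvPolynomial ι ℂ} {m : ℕ}
    (hA : A.IsHomogeneous m) (B : MvPolynomial ι ℂ) :
    ∑ q, fockInner (pderiv q A) (pderiv q B) = (m : ℂ) * fockInner A B := by
  have h1 : ∀ q, fockInner (pderiv q A) (pderiv q B) = fockInner (X q * pderiv q A) B := by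
    intro q
    rw [← cr_apply, fockInner_cr_left, an_apply]
  simp_rw [h1]
  have key : ∀ s : Finset ι, ∑ q ∈ s, fockInner (X q * pderiv q A) B =
      fockInner (∑ q ∈ s, X q * pderiv q A) B := by
    intro s
    induction s using Finset.cons_induction with
    | empty => simp [fockInner_zero_left]
    | cons a s ha ih => rw [Finset.sum_cons, Finset.sum_cons, fockInner_add_left, ih]
  rw [key, hA.sum_X_mul_pderiv, ← Nat.cast_smul_eq_nsmul ℂ, fockInner_smul_left, Complex.conj_natCast]

/-- A homogeneous polynomial of degree `0` is the constant `C (coeff 0 A)`. [folklore] -/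
theorem eq_C_of_isHomogeneous_zero {A : MvPolynomial ι ℂ} (hA : A.IsHomogeneous 0) :
    A = C (coeff 0 A) := by
  classical
  refine MvPolynomial.ext _ _ fun d => ?_
  rw [coeff_C]
  by_cases hd : 0 = d
  · subst hd; rfl
  · rw [if_neg hd]
    apply hA.coeff_eq_zero
    intro h
    exact hd ((Finsupp.degree_eq_zero_iff d).1 h).symm

/-- `∂_p` lowers the degree of a homogeneous polynomial by one. [folklore] -/
theorem isHomogeneous_pderiv_of_succ {A : MvPolynomial ι ℂ} {n : ℕ} (hA : A.IsHomogeneous (n + 1))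
    (p : ι) : (pderiv p A).IsHomogeneous n := by
  intro d hd
  rw [coeff_pderiv] at hd
  have h1 : coeff (d + Finsupp.single p 1) A ≠ 0 := fun h => hd (by rw [h, zero_mul])
  have h2 := hA h1
  rw [Finsupp.weight_apply] at h2 ⊢
  simp only [Pi.one_apply, smul_eq_mul, mul_one] at h2 ⊢
  have h3 : (d + Finsupp.single p 1).sum (fun _ e => e) = d.sum (fun _ e => e) + 1 := by
    rw [Finsupp.sum_add_index' (fun _ => rfl) (fun _ _ _ => rfl), Finsupp.sum_single_index rfl]
  omega

/-- `⟨C a, C b⟩ = conj(a) b`. [folklore] -/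
theorem fockInner_C_C (a b : ℂ) : fockInner (C a : MvPolynomial ι ℂ) (C b) = conj a * b := by
  classical
  rw [show (C a : MvPolynomial ι ℂ) = monomial 0 a from rfl,
    show (C b : MvPolynomial ι ℂ) = monomial 0 b from rfl, fockInner_monomial, if_pos rfl]
  simp [occFactorial]

/-- **The amplitude picture is isometric**: `∑_k conj(ψ̃_A(k)) ψ̃_B(k) = ⟨A, B⟩_Fock` for `A, B`
homogeneous of degree `n` — the ordered-word amplitudes carry the Fock inner product
`⟨X^d, X^e⟩ = δ_{de} d!` (proved by induction on `n` through the annihilation recursion and the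
polarised Euler identity, without counting words). [cite: LSSY2005, App. A (A.9)] -/
theorem sum_conj_amp_mul_amp [Fintype ι] [DecidableEq ι] {n : ℕ} {A B : MvPolynomial ι ℂ}
    (hA : A.IsHomogeneous n) (hB : B.IsHomogeneous n) :
    ∑ k : Fin n → ι, conj (amp A n k) * amp B n k = fockInner A B := by
  induction n generalizing A B with
  | zero =>
    rw [Fintype.sum_unique, amp_zero_word, amp_zero_word]
    conv_rhs => rw [eq_C_of_isHomogeneous_zero hA, eq_C_of_isHomogeneous_zero hB]
    rw [fockInner_C_C]
  | succ n ih =>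
    rw [← (Fin.consEquiv fun _ : Fin (n + 1) => ι).sum_comp, Fintype.sum_prod_type]
    have hcons : ∀ (p : ι) (k : Fin n → ι),
        (Fin.consEquiv fun _ : Fin (n + 1) => ι) (p, k) = Fin.cons p k := by
      intro p k; rfl
    simp only [hcons, amp_cons, map_mul, Complex.conj_ofReal]
    have hc : ((((Real.sqrt ((n : ℝ) + 1))⁻¹ : ℝ) : ℂ)) * (((Real.sqrt ((n : ℝ) + 1))⁻¹ : ℝ) : ℂ) =
        (((n : ℝ) + 1)⁻¹ : ℝ) := by
      rw [← Complex.ofReal_mul, ← mul_inv, Real.mul_self_sqrt (by positivity)]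
    calc ∑ p, ∑ k : Fin n → ι, (((Real.sqrt ((n : ℝ) + 1))⁻¹ : ℝ) : ℂ) * conj (amp (pderiv p A) n k) *
          ((((Real.sqrt ((n : ℝ) + 1))⁻¹ : ℝ) : ℂ) * amp (pderiv p B) n k)
        = ∑ p, (((n : ℝ) + 1)⁻¹ : ℝ) * ∑ k : Fin n → ι, conj (amp (pderiv p A) n k) * amp (pderiv p B) n k := by
          refine Finset.sum_congr rfl fun p _ => ?_
          rw [Finset.mul_sum]
          refine Finset.sum_congr rfl fun k _ => ?_
          rw [← hc]; ring
      _ = (((n : ℝ) + 1)⁻¹ : ℝ) * ∑ p, fockInner (pderiv p A) (pderiv p B) := by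
          rw [Finset.mul_sum]
          refine Finset.sum_congr rfl fun p _ => ?_
          rw [ih (isHomogeneous_pderiv_of_succ hA p) (isHomogeneous_pderiv_of_succ hB p)]
      _ = fockInner A B := by
          rw [sum_fockInner_pderiv_pderiv hA]
          push_cast
          have : ((n : ℂ) + 1) ≠ 0 := by exact_mod_cast Nat.succ_ne_zero n
          field_simp

end Words

end Fock

/-! ### The `n`-body wave function of a finite-mode sector on the torus -/

open Fock

variable {ι : Type*}

/-- The **`n`-body wave function of the sector `A`** on the torus of side `L`, for a finite set of
modes `ι` labelled by momenta `e : ι → ℤ³`: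
`Ψ_A(x₁,…,x_n) = ∑_{k ∈ ιⁿ} ψ̃_A(k) e_{e(k₁)}(x₁)⋯e_{e(k_n)}(x_n)`, `e_m(x) = e^{2πi m·x/L}` — the
first-quantised meaning of `A = ∑_d a_d (a†)^d|0⟩` [(A.9)]: a Bose-symmetric trigonometric
polynomial, `Lℤ³`-periodic in each particle. (Plane waves unnormalised: `‖Ψ_A‖²_{L²(Λⁿ)} = L^{3n}‖A‖²`.)
[cite: LSSY2005, App. A (A.5), (A.9)] -/
def sectorWave [Fintype ι] (L : ℝ) (e : ι → Momentum) (A : MvPolynomial ι ℂ) (n : ℕ)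
    (X : Config n) : ℂ :=
  ∑ k : Fin n → ι, amp A n k * ∏ i, cellWave L (e (k i)) (X i)

section SectorWave

variable [Fintype ι] {L : ℝ} {e : ι → Momentum}

omit [Fintype ι] in
/-- A product of plane waves has modulus `1`. [folklore] -/
theorem norm_prod_cellWave {n : ℕ} (L : ℝ) (m : Fin n → Momentum) (X : Config n) :
    ‖∏ i, cellWave L (m i) (X i)‖ = 1 := by
  rw [norm_prod]
  simp [norm_cellWave]

/-- **Uniform bound**: `|Ψ_A(X)| ≤ ∑_k |ψ̃_A(k)|`. [folklore] -/
theorem norm_sectorWave_le (L : ℝ) (e : ι → Momentum) (A : MvPolynomial ι ℂ) (n : ℕ)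
    (X : Config n) : ‖sectorWave L e A n X‖ ≤ ∑ k : Fin n → ι, ‖amp A n k‖ := by
  unfold sectorWave
  refine (norm_sum_le _ _).trans (Finset.sum_le_sum fun k _ => ?_)
  rw [norm_mul, norm_prod_cellWave, mul_one]

/-- `Ψ_A` is smooth (a trigonometric polynomial). [folklore] -/
theorem contDiff_sectorWave (L : ℝ) (e : ι → Momentum) (A : MvPolynomial ι ℂ) (n : ℕ)
    (m : ℕ∞) : ContDiff ℝ m (sectorWave L e A n) := by
  unfold sectorWave
  refine ContDiff.sum fun k _ => contDiff_const.mul ?_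
  refine contDiff_prod fun i _ => ?_
  exact ((contDiff_cellWave L (e (k i))).of_le (mod_cast le_top)).comp (contDiff_apply ℝ Space i)

/-- `Ψ_A` is continuous. [folklore] -/
theorem continuous_sectorWave (L : ℝ) (e : ι → Momentum) (A : MvPolynomial ι ℂ) (n : ℕ) :
    Continuous (sectorWave L e A n) :=
  (contDiff_sectorWave L e A n 0).continuous

/-- **`Ψ_A` is `Lℤ³`-periodic in each particle.** [cite: LSSY2005, App. A (A.5)] -/
theorem sectorWave_periodic (hL : L ≠ 0) (e : ι → Momentum) (A : MvPolynomial ι ℂ) {n : ℕ}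
    (X : Config n) (i : Fin n) (j : Fin 3) :
    sectorWave L e A n (X + Pi.single i (EuclideanSpace.single j L)) = sectorWave L e A n X := by
  unfold sectorWave
  refine Finset.sum_congr rfl fun k _ => ?_
  congr 1
  refine Finset.prod_congr rfl fun l _ => ?_
  rw [Pi.add_apply]
  by_cases hl : l = i
  · subst hl
    rw [Pi.single_eq_same, cellWave_periodic hL]
  · rw [Pi.single_eq_of_ne hl, add_zero]

/-- **`Ψ_A` is Bose-symmetric.** [cite: LSSY2005, App. A (A.9)] -/
theorem sectorWave_comp_perm (L : ℝ) (e : ι → Momentum) (A : MvPolynomial ι ℂ) {n : ℕ}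
    (τ : Equiv.Perm (Fin n)) (X : Config n) :
    sectorWave L e A n (X ∘ τ) = sectorWave L e A n X := by
  unfold sectorWave
  -- reindex the words by `k ↦ k ∘ τ⁻¹`
  rw [← Equiv.sum_comp (τ.symm.arrowCongr (Equiv.refl ι))]
  refine Finset.sum_congr rfl fun k _ => ?_
  have hk : (τ.symm.arrowCongr (Equiv.refl ι)) k = k ∘ τ := by
    funext i; simp [Equiv.arrowCongr_apply]
  rw [hk, amp_comp_perm]
  congr 1
  -- `∏_i e_{k(τ i)}(X(τ i)) = ∏_j e_{k j}(X j)`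
  exact Equiv.prod_comp τ (fun j => cellWave L (e (k j)) (X j))

/-! ### Orthogonality of the plane-wave products on `Λⁿ` and the `L²` isometry -/

omit [Fintype ι] in
/-- Bounded continuous functions are integrable on `Λⁿ`. [folklore] -/
theorem integrableOn_cellN_of_bounded {n : ℕ} (L : ℝ) {F : Config n → ℂ} (hF : Continuous F)
    {M : ℝ} (hM : ∀ X, ‖F X‖ ≤ M) : IntegrableOn F (cellN n L) := by
  refine Measure.integrableOn_of_bounded ?_ hF.aestronglyMeasurable (Filter.Eventually.of_forall hM)
  rw [volume_cellN]
  exact (ENNReal.pow_lt_top (ENNReal.pow_lt_top ENNReal.ofReal_lt_top)).ne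

omit [Fintype ι] in
/-- `∫_{Λ} e_m = [m = 0] L³`. [folklore] -/
theorem integral_cell_cellWave {L : ℝ} (hL : 0 < L) (m : Momentum) :
    ∫ x in cell L, cellWave L m x = if m = 0 then (L : ℂ) ^ 3 else 0 := by
  by_cases hm : m = 0
  · rw [if_pos hm, hm, integral_cell_cellWave_zero hL]
  · rw [if_neg hm, integral_cell_cellWave_eq_zero hL hm]

omit [Fintype ι] in
/-- **Orthogonality of the plane-wave products**: `∫_{Λⁿ} ∏ᵢ e_{mᵢ}(xᵢ) dX = [m = 0] L^{3n}`
(Fubini, `MeasureTheory.integral_fin_nat_prod_eq_prod`). [cite: LSSY2005, App. A (A.5)] -/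
theorem integral_cellN_prod_cellWave {L : ℝ} (hL : 0 < L) {n : ℕ} (m : Fin n → Momentum) :
    ∫ X in cellN n L, ∏ i, cellWave L (m i) (X i) = if m = 0 then ((L : ℂ) ^ 3) ^ n else 0 := by
  rw [volume_restrict_cellN, integral_fin_nat_prod_eq_prod]
  simp only [integral_cell_cellWave hL]
  by_cases hm : m = 0
  · subst hm
    simp
  · rw [if_neg hm]
    obtain ⟨i, hi⟩ : ∃ i, m i ≠ 0 := by
      by_contra h
      push Not at h
      exact hm (funext h)
    exact Finset.prod_eq_zero (Finset.mem_univ i) (if_neg hi)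

/-- **The plane-wave products are orthogonal on `Λⁿ`**: for an injective labelling `e` and
arbitrary coefficient families `a, b`,
`∫_{Λⁿ} conj(∑_k a_k ∏ᵢe_{e(kᵢ)}(xᵢ)) (∑_k b_k ∏ᵢe_{e(kᵢ)}(xᵢ)) dX = L^{3n} ∑_k conj(a_k) b_k`.
[cite: LSSY2005, App. A (A.5)] -/
theorem integral_cellN_conj_wordSum_mul_wordSum {L : ℝ} (hL : 0 < L) (he : Function.Injective e)
    {n : ℕ} (a b : (Fin n → ι) → ℂ) :
    ∫ X in cellN n L, conj (∑ k : Fin n → ι, a k * ∏ i, cellWave L (e (k i)) (X i)) *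
        (∑ k : Fin n → ι, b k * ∏ i, cellWave L (e (k i)) (X i)) =
      ((L : ℂ) ^ 3) ^ n * ∑ k : Fin n → ι, conj (a k) * b k := by
  -- expand the product of the two sums into a double sum of plane-wave products
  have hexp : ∀ X : Config n, conj (∑ k : Fin n → ι, a k * ∏ i, cellWave L (e (k i)) (X i)) *
      (∑ k : Fin n → ι, b k * ∏ i, cellWave L (e (k i)) (X i)) =
      ∑ k : Fin n → ι, ∑ k' : Fin n → ι, conj (a k) * b k' *
        ∏ i, cellWave L (e (k' i) - e (k i)) (X i) := by
    intro X
    rw [map_sum, Finset.sum_mul]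
    refine Finset.sum_congr rfl fun k _ => ?_
    rw [Finset.mul_sum]
    refine Finset.sum_congr rfl fun k' _ => ?_
    rw [map_mul, map_prod]
    simp only [conj_cellWave]
    have hprod : (∏ i, cellWave L (-e (k i)) (X i)) * ∏ i, cellWave L (e (k' i)) (X i) =
        ∏ i, cellWave L (e (k' i) - e (k i)) (X i) := by
      rw [← Finset.prod_mul_distrib]
      refine Finset.prod_congr rfl fun i _ => ?_
      rw [← cellWave_add_index, neg_add_eq_sub]
    rw [← hprod]; ring
  simp_rw [hexp]
  -- integrate term by term
  have hint : ∀ (k k' : Fin n → ι), IntegrableOn (fun X : Config n => conj (a k) * b k' *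
      ∏ i, cellWave L (e (k' i) - e (k i)) (X i)) (cellN n L) := by
    intro k k'
    refine integrableOn_cellN_of_bounded L (M := ‖conj (a k) * b k'‖) ?_ fun X => ?_
    · refine continuous_const.mul (continuous_finsetProd _ fun i _ => ?_)
      exact (continuous_cellWave L _).comp (continuous_apply i)
    · rw [norm_mul, norm_prod_cellWave, mul_one]
  rw [integral_finsetSum _ fun k _ => (integrable_finsetSum _ fun k' _ => hint k k')]
  simp_rw [integral_finsetSum _ fun k' _ => hint _ k', integral_const_mul,
    integral_cellN_prod_cellWave hL]
  -- `∏` orthogonality: the word `e ∘ k' - e ∘ k` vanishes iff `k' = k`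
  have hδ : ∀ k k' : Fin n → ι, ((fun i => e (k' i) - e (k i)) = 0 ↔ k' = k) := by
    intro k k'
    constructor
    · intro h; funext i
      have := congr_fun h i
      exact he (sub_eq_zero.1 this)
    · rintro rfl; funext i; simp
  rw [Finset.mul_sum]
  refine Finset.sum_congr rfl fun k _ => ?_
  rw [Finset.sum_eq_single k]
  · rw [if_pos ((hδ k k).2 rfl)]; ring
  · intro k' _ hk'
    rw [if_neg (fun h => hk' ((hδ k k').1 h)), mul_zero]
  · intro h; exact absurd (Finset.mem_univ k) h

/-- **The `L²(Λⁿ)` inner product of two sectors is the Fock inner product**: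
`∫_{Λⁿ} conj(Ψ_A) Ψ_B = L^{3n} ⟨A, B⟩` for `A, B` homogeneous of degree `n` (the isomorphism (A.9)
is unitary up to the volume factor of the unnormalised plane waves). [cite: LSSY2005, App. A (A.9)] -/
theorem integral_cellN_conj_sectorWave_mul_sectorWave [DecidableEq ι] {L : ℝ} (hL : 0 < L)
    (he : Function.Injective e) {n : ℕ} {A B : MvPolynomial ι ℂ} (hA : A.IsHomogeneous n)
    (hB : B.IsHomogeneous n) :
    ∫ X in cellN n L, conj (sectorWave L e A n X) * sectorWave L e B n X =
      ((L : ℂ) ^ 3) ^ n * fockInner A B := by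
  unfold sectorWave
  rw [integral_cellN_conj_wordSum_mul_wordSum hL he, sum_conj_amp_mul_amp hA hB]

/-- **The `L²(Λⁿ)` norm of a sector**: `∫_{Λⁿ} |Ψ_A|² = L^{3n} ‖A‖²` (as a real number).
[cite: LSSY2005, App. A (A.9)] -/
theorem integral_cellN_norm_sq_sectorWave [DecidableEq ι] {L : ℝ} (hL : 0 < L)
    (he : Function.Injective e) {n : ℕ} {A : MvPolynomial ι ℂ} (hA : A.IsHomogeneous n) :
    ∫ X in cellN n L, ‖sectorWave L e A n X‖ ^ 2 = (L ^ 3) ^ n * (fockInner A A).re := by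
  have h := integral_cellN_conj_sectorWave_mul_sectorWave hL he hA hA
  have h1 : (fun X => conj (sectorWave L e A n X) * sectorWave L e A n X) =
      fun X => ((‖sectorWave L e A n X‖ ^ 2 : ℝ) : ℂ) := by
    funext X; rw [Complex.conj_mul', Complex.ofReal_pow]
  rw [h1, integral_complex_ofReal] at h
  have h3 : (((L : ℂ) ^ 3) ^ n) = (((L ^ 3) ^ n : ℝ) : ℂ) := by push_cast; ring
  rw [h3] at h
  have h2 := congrArg Complex.re h
  rw [Complex.ofReal_re, Complex.re_ofReal_mul] at h2
  exact h2

/-! ### The gradient of `Ψ_A` and the kinetic energy -/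

omit [Fintype ι] in
/-- The plane waves are differentiable. [folklore] -/
theorem differentiableAt_cellWave (L : ℝ) (m : Momentum) (x : Space) :
    DifferentiableAt ℝ (cellWave L m) x :=
  (((contDiff_cellWave L m).of_le (mod_cast le_top) : ContDiff ℝ 1 _).differentiable one_ne_zero).differentiableAt

/-- **The partial derivatives of `Ψ_A`**: `∂_{xᵢ,j} Ψ_A(X) = ∑_k ψ̃_A(k) (2πi e(kᵢ)ⱼ/L) ∏_l e_{e(k_l)}(x_l)`
(each plane-wave product is an eigenfunction of `-i∇ᵢ` with eigenvalue `2πe(kᵢ)/L`).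
[cite: LSSY2005, App. A (A.6)] -/
theorem fderiv_sectorWave_single (L : ℝ) (e : ι → Momentum) (A : MvPolynomial ι ℂ) {n : ℕ}
    (X : Config n) (i : Fin n) (j : Fin 3) :
    fderiv ℝ (sectorWave L e A n) X (Pi.single i (EuclideanSpace.single j (1 : ℝ))) =
      ∑ k : Fin n → ι, amp A n k * ((2 * Real.pi * Complex.I * (e (k i) j) / L) *
        ∏ l, cellWave L (e (k l)) (X l)) := by
  classical
  have hterm : ∀ k : Fin n → ι, HasFDerivAt (fun X : Config n => amp A n k * ∏ l, cellWave L (e (k l)) (X l))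
      (amp A n k • ∑ l, (∏ l' ∈ Finset.univ.erase l, cellWave L (e (k l')) (X l')) •
        ((fderiv ℝ (cellWave L (e (k l))) (X l)).comp (ContinuousLinearMap.proj l))) X := by
    intro k
    have hf : ∀ l ∈ (Finset.univ : Finset (Fin n)),
        HasFDerivAt (fun X : Config n => cellWave L (e (k l)) (X l))
          ((fderiv ℝ (cellWave L (e (k l))) (X l)).comp (ContinuousLinearMap.proj l)) X :=
      fun l _ => by
        have hproj := (ContinuousLinearMap.proj (R := ℝ) (φ := fun _ : Fin n => Space) l).hasFDerivAt
          (x := X)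
        exact (differentiableAt_cellWave L (e (k l)) (X l)).hasFDerivAt.comp X hproj
    exact (HasFDerivAt.finsetProd hf).const_mul (amp A n k)
  have hsum := HasFDerivAt.fun_sum (u := Finset.univ) fun k _ => hterm k
  have hfun : (fun X : Config n => ∑ k ∈ Finset.univ, amp A n k * ∏ l, cellWave L (e (k l)) (X l)) =
      sectorWave L e A n := by
    funext X; rfl
  rw [hfun] at hsum
  rw [hsum.fderiv, _root_.sum_apply]
  refine Finset.sum_congr rfl fun k _ => ?_
  rw [smul_apply, _root_.sum_apply, smul_eq_mul]
  congr 1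
  rw [Finset.sum_eq_single i]
  · rw [smul_apply, ContinuousLinearMap.comp_apply, ContinuousLinearMap.proj_apply,
      Pi.single_eq_same, fderiv_cellWave_apply_single, smul_eq_mul, mul_left_comm,
      Finset.prod_erase_mul _ _ (Finset.mem_univ i)]
  · intro l _ hl
    rw [smul_apply, ContinuousLinearMap.comp_apply, ContinuousLinearMap.proj_apply,
      Pi.single_eq_of_ne hl, map_zero, smul_zero]
  · intro h; exact absurd (Finset.mem_univ i) h

omit [Fintype ι] in
/-- `∑ⱼ |2π mⱼ/L|² = |2πm/L|²`. [cite: LSSY2005, App. A (A.6)] -/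
theorem sum_norm_sq_momentumComponent (L : ℝ) (m : Momentum) :
    ∑ j : Fin 3, ‖(2 * Real.pi * Complex.I * (m j) / L : ℂ)‖ ^ 2 = ‖waveVector L m‖ ^ 2 := by
  rw [norm_waveVector_sq, Finset.mul_sum, Finset.sum_div]
  refine Finset.sum_congr rfl fun j _ => ?_
  rw [Complex.norm_div, Complex.norm_mul, Complex.norm_mul, Complex.norm_mul, Complex.norm_I,
    Complex.norm_real, Complex.norm_two, Complex.norm_intCast, Complex.norm_real,
    Real.norm_of_nonneg Real.pi_pos.le, Real.norm_eq_abs]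
  simp only [div_pow, mul_pow, sq_abs]
  ring

/-- **The occupation-weighted amplitude sum**: for `A` homogeneous of degree `n` and any weight
`w` on the modes, `∑ᵢ ∑_k |ψ̃_A(k)|² w(kᵢ) = ∑_p w_p ‖a_pA‖²` — the first-quantised one-body sum
`∑ᵢ w(kᵢ)` is the second-quantised `∑_p w_p a†_pa_p` [(A.10)–(A.11)] (Bose symmetry moves each
particle to the first slot; the annihilation recursion and the isometry finish).
[cite: LSSY2005, App. A (A.10)–(A.11)] -/
theorem sum_sum_norm_sq_amp_mul_weight [DecidableEq ι] (w : ι → ℝ) {n : ℕ} {A : MvPolynomial ι ℂ}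
    (hA : A.IsHomogeneous n) :
    ∑ i : Fin n, ∑ k : Fin n → ι, ‖amp A n k‖ ^ 2 * w (k i) =
      ∑ p, w p * (fockInner (pderiv p A) (pderiv p A)).re := by
  cases n with
  | zero =>
    rw [Finset.univ_eq_empty, Finset.sum_empty]
    symm
    refine Finset.sum_eq_zero fun p _ => ?_
    rw [eq_C_of_isHomogeneous_zero hA, pderiv_C, fockInner_zero_left, Complex.zero_re, mul_zero]
  | succ m =>
    -- Step 1: every slot contributes the same as slot `0`
    have hslot : ∀ i : Fin (m + 1), ∑ k : Fin (m + 1) → ι, ‖amp A (m + 1) k‖ ^ 2 * w (k i) =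
        ∑ k : Fin (m + 1) → ι, ‖amp A (m + 1) k‖ ^ 2 * w (k 0) := by
      intro i
      rw [← Equiv.sum_comp ((Equiv.swap 0 i).arrowCongr (Equiv.refl ι))]
      refine Finset.sum_congr rfl fun k _ => ?_
      have hk : ((Equiv.swap 0 i).arrowCongr (Equiv.refl ι)) k = k ∘ (Equiv.swap 0 i) := by
        funext l; simp [Equiv.arrowCongr_apply, Equiv.symm_swap]
      rw [hk, amp_comp_perm]
      simp
    -- Step 2: slot `0` through the annihilation recursion and the isometry
    have h0 : ∑ k : Fin (m + 1) → ι, ‖amp A (m + 1) k‖ ^ 2 * w (k 0) =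
        (((m : ℝ) + 1)⁻¹) * ∑ p, w p * (fockInner (pderiv p A) (pderiv p A)).re := by
      rw [← (Fin.consEquiv fun _ : Fin (m + 1) => ι).sum_comp, Fintype.sum_prod_type]
      have hcons : ∀ (p : ι) (k : Fin m → ι),
          (Fin.consEquiv fun _ : Fin (m + 1) => ι) (p, k) = Fin.cons p k := by
        intro p k; rfl
      simp only [hcons, Fin.cons_zero, amp_cons, norm_mul, mul_pow, Complex.norm_real, norm_inv,
        Real.norm_of_nonneg (Real.sqrt_nonneg _), inv_pow, Real.sq_sqrt (by positivity : (0:ℝ) ≤ (m:ℝ) + 1)]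
      rw [Finset.mul_sum]
      refine Finset.sum_congr rfl fun p _ => ?_
      have hiso := congrArg Complex.re (sum_conj_amp_mul_amp (isHomogeneous_pderiv_of_succ hA p)
        (isHomogeneous_pderiv_of_succ hA p))
      rw [Complex.re_sum] at hiso
      simp only [Complex.conj_mul', ← Complex.ofReal_pow, Complex.ofReal_re] at hiso
      rw [← hiso]
      simp only [Finset.mul_sum]
      refine Finset.sum_congr rfl fun k _ => ?_
      ring
    simp only [hslot, h0, Finset.sum_const, Finset.card_univ, Fintype.card_fin, nsmul_eq_mul]
    push_cast
    have : ((m : ℝ) + 1) ≠ 0 := by positivity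
    field_simp

/-- **The kinetic energy of a sector**:
`∫_{Λⁿ} ∑ᵢ |∇ᵢΨ_A|² = L^{3n} ∑_p |2πe(p)/L|² ‖a_pA‖²`, i.e. `⟨Ψ_A, ∑ᵢ(-Δᵢ)Ψ_A⟩ = L^{3n} ⟨A, ∑_p ε(p) a†_pa_p A⟩`
with `ε(p) = |2πe(p)/L|²` — the kinetic term of (A.10). [cite: LSSY2005, App. A (A.6), (A.10)] -/
theorem integral_cellN_kinetic_sectorWave [DecidableEq ι] {L : ℝ} (hL : 0 < L)
    (he : Function.Injective e) {n : ℕ} {A : MvPolynomial ι ℂ} (hA : A.IsHomogeneous n) :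
    ∫ X in cellN n L, (∑ i : Fin n, ∑ j : Fin 3,
        ‖fderiv ℝ (sectorWave L e A n) X (Pi.single i (EuclideanSpace.single j (1 : ℝ)))‖ ^ 2) =
      (L ^ 3) ^ n * ∑ p, ‖waveVector L (e p)‖ ^ 2 * (fockInner (pderiv p A) (pderiv p A)).re := by
  -- the partial derivatives are word sums with the modified amplitudes `ψ̃(k)·(2πi e(kᵢ)ⱼ/L)`
  set a : Fin n → Fin 3 → (Fin n → ι) → ℂ := fun i j k =>
    amp A n k * (2 * Real.pi * Complex.I * (e (k i) j) / L) with ha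
  have hD : ∀ (i : Fin n) (j : Fin 3) (X : Config n),
      fderiv ℝ (sectorWave L e A n) X (Pi.single i (EuclideanSpace.single j (1 : ℝ))) =
        ∑ k : Fin n → ι, a i j k * ∏ l, cellWave L (e (k l)) (X l) := by
    intro i j X
    rw [fderiv_sectorWave_single]
    refine Finset.sum_congr rfl fun k _ => ?_
    rw [ha]; ring
  -- each `∫ |∂_{i,j}Ψ|²`
  have hij : ∀ (i : Fin n) (j : Fin 3), ∫ X in cellN n L,
      ‖fderiv ℝ (sectorWave L e A n) X (Pi.single i (EuclideanSpace.single j (1 : ℝ)))‖ ^ 2 =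
      (L ^ 3) ^ n * ∑ k : Fin n → ι, ‖a i j k‖ ^ 2 := by
    intro i j
    have h := integral_cellN_conj_wordSum_mul_wordSum hL he (a i j) (a i j)
    simp only [← hD] at h
    have h1 : (fun X => conj (fderiv ℝ (sectorWave L e A n) X (Pi.single i (EuclideanSpace.single j (1 : ℝ)))) *
        fderiv ℝ (sectorWave L e A n) X (Pi.single i (EuclideanSpace.single j (1 : ℝ)))) =
        fun X => ((‖fderiv ℝ (sectorWave L e A n) X (Pi.single i (EuclideanSpace.single j (1 : ℝ)))‖ ^ 2 : ℝ) : ℂ) := by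
      funext X; rw [Complex.conj_mul', Complex.ofReal_pow]
    rw [h1, integral_complex_ofReal] at h
    simp only [Complex.conj_mul', ← Complex.ofReal_pow] at h
    rw [← Complex.ofReal_sum, ← Complex.ofReal_mul] at h
    exact_mod_cast h
  -- integrability of the summands (bounded continuous word sums)
  have hint : ∀ (i : Fin n) (j : Fin 3), Integrable (fun X : Config n =>
      ‖fderiv ℝ (sectorWave L e A n) X (Pi.single i (EuclideanSpace.single j (1 : ℝ)))‖ ^ 2)
      (volume.restrict (cellN n L)) := by
    intro i j
    have hcont : Continuous fun X : Config n => ∑ k : Fin n → ι, a i j k * ∏ l, cellWave L (e (k l)) (X l) := by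
      refine continuous_finsetSum _ fun k _ => continuous_const.mul ?_
      exact continuous_finsetProd _ fun l _ => (continuous_cellWave L _).comp (continuous_apply l)
    have hb : ∀ X : Config n, ‖((‖∑ k : Fin n → ι, a i j k * ∏ l, cellWave L (e (k l)) (X l)‖ ^ 2 : ℝ) : ℂ)‖ ≤
        (∑ k : Fin n → ι, ‖a i j k‖) ^ 2 := by
      intro X
      rw [Complex.norm_real, Real.norm_of_nonneg (sq_nonneg _)]
      refine pow_le_pow_left₀ (norm_nonneg _) ((norm_sum_le _ _).trans (Finset.sum_le_sum fun k _ => ?_)) 2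
      rw [norm_mul, norm_prod_cellWave, mul_one]
    have hI := integrableOn_cellN_of_bounded L (F := fun X => ((‖∑ k : Fin n → ι, a i j k *
      ∏ l, cellWave L (e (k l)) (X l)‖ ^ 2 : ℝ) : ℂ)) (by fun_prop) hb
    have hI' := hI.re
    simp only [← hD] at hI'
    exact hI'
  rw [integral_finsetSum _ fun i _ => integrable_finsetSum _ fun j _ => hint i j]
  simp_rw [integral_finsetSum _ fun j _ => hint _ j, hij, ← Finset.mul_sum]
  congr 1
  -- `∑ᵢ ∑ⱼ ∑_k |ψ̃(k)|² |2π e(kᵢ)ⱼ/L|² = ∑_p |2πe(p)/L|² ‖a_pA‖²`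
  have hw : ∀ i : Fin n, ∑ j : Fin 3, ∑ k : Fin n → ι, ‖a i j k‖ ^ 2 =
      ∑ k : Fin n → ι, ‖amp A n k‖ ^ 2 * ‖waveVector L (e (k i))‖ ^ 2 := by
    intro i
    rw [Finset.sum_comm]
    refine Finset.sum_congr rfl fun k _ => ?_
    simp only [ha, norm_mul, mul_pow, ← Finset.mul_sum, sum_norm_sq_momentumComponent]
  simp_rw [hw]
  exact sum_sum_norm_sq_amp_mul_weight (fun p => ‖waveVector L (e p)‖ ^ 2) hA

/-! ### The normalised sector as a periodic trial state; the variational bound -/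

omit [Fintype ι] in
/-- `⟨A, A⟩ > 0` for `A ≠ 0`. [folklore] -/
theorem fockInner_self_re_pos {A : MvPolynomial ι ℂ} (hA0 : A ≠ 0) : 0 < (fockInner A A).re := by
  rcases (fockInner_self_re_nonneg A).lt_or_eq with h | h
  · exact h
  · exfalso
    apply hA0
    rw [fockInner_self, Complex.ofReal_re] at h
    rw [← fockInner_self_eq_zero, fockInner_self, ← h, Complex.ofReal_zero]

/-- The **normalised `n`-body wave function** `Ψ_A / ‖Ψ_A‖` of a non-zero sector `A`,
`‖Ψ_A‖² = L^{3n}⟨A, A⟩`, packaged as a periodic trial state (smooth, `Lℤ³`-periodic,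
Bose-symmetric, normalised on `Λⁿ`). [cite: LSSY2005, App. A (A.9)] -/
def sectorTrialState [DecidableEq ι] {L : ℝ} (hL : 0 < L) {e : ι → Momentum}
    (he : Function.Injective e) {n : ℕ} {A : MvPolynomial ι ℂ} (hA : A.IsHomogeneous n)
    (hA0 : A ≠ 0) : PeriodicTrialState n L where
  ψ X := (((Real.sqrt ((L ^ 3) ^ n * (fockInner A A).re))⁻¹ : ℝ) : ℂ) * sectorWave L e A n X
  contDiff := contDiff_const.mul (contDiff_sectorWave L e A n 1)
  periodic X i k := by
    change _ * sectorWave L e A n (X + _) = _ * sectorWave L e A n X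
    rw [sectorWave_periodic hL.ne']
  symm τ X := by
    rw [sectorWave_comp_perm]
  norm_eq := by
    set N₂ : ℝ := (L ^ 3) ^ n * (fockInner A A).re with hN₂
    have hN₂0 : 0 < N₂ := mul_pos (by positivity) (fockInner_self_re_pos hA0)
    have hpt : ∀ X : Config n, ((‖(((Real.sqrt N₂)⁻¹ : ℝ) : ℂ) * sectorWave L e A n X‖₊ : ℝ≥0∞) ^ 2) =
        ENNReal.ofReal (N₂⁻¹ * ‖sectorWave L e A n X‖ ^ 2) := by
      intro X
      rw [coe_nnnorm_sq_eq_ofReal, norm_mul, mul_pow, Complex.norm_real, norm_inv,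
        Real.norm_of_nonneg (Real.sqrt_nonneg _), inv_pow, Real.sq_sqrt hN₂0.le]
    simp only [hpt]
    have hint : Integrable (fun X : Config n => N₂⁻¹ * ‖sectorWave L e A n X‖ ^ 2)
        (volume.restrict (cellN n L)) := by
      have hI := integrableOn_cellN_of_bounded L (F := fun X => (((N₂⁻¹ * ‖sectorWave L e A n X‖ ^ 2 : ℝ)) : ℂ))
        (by
          have := continuous_sectorWave L e A n
          fun_prop)
        (M := N₂⁻¹ * (∑ k : Fin n → ι, ‖amp A n k‖) ^ 2) (fun X => by
          rw [Complex.norm_real, Real.norm_of_nonneg (by positivity)]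
          gcongr
          exact norm_sectorWave_le L e A n X)
      have hI' := hI.re
      simp only [RCLike.re_to_complex, Complex.ofReal_re] at hI'
      exact hI'
    rw [← ofReal_integral_eq_lintegral_ofReal hint (Filter.Eventually.of_forall fun X => by positivity),
      integral_const_mul, integral_cellN_norm_sq_sectorWave hL he hA, ← hN₂, inv_mul_cancel₀ hN₂0.ne',
      ENNReal.ofReal_one]

/-- The wave function of the packaged state. [folklore] -/
theorem sectorTrialState_ψ [DecidableEq ι] {L : ℝ} (hL : 0 < L) {e : ι → Momentum}
    (he : Function.Injective e) {n : ℕ} {A : MvPolynomial ι ℂ} (hA : A.IsHomogeneous n)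
    (hA0 : A ≠ 0) (X : Config n) :
    (sectorTrialState hL he hA hA0).ψ X =
      (((Real.sqrt ((L ^ 3) ^ n * (fockInner A A).re))⁻¹ : ℝ) : ℂ) * sectorWave L e A n X := rfl

omit [Fintype ι] in
/-- `|∇(cF)|² = |c|²|∇F|²` pointwise for a differentiable `F`. [folklore] -/
theorem kineticDensity_const_mul' {n : ℕ} (c : ℂ) {F : Config n → ℂ} (hF : Differentiable ℝ F)
    (X : Config n) :
    kineticDensity (fun Y => c * F Y) X = (‖c‖₊ : ℝ≥0∞) ^ 2 * kineticDensity F X := by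
  unfold kineticDensity
  rw [Finset.mul_sum]
  refine Finset.sum_congr rfl fun i _ => ?_
  rw [Finset.mul_sum]
  refine Finset.sum_congr rfl fun a _ => ?_
  rw [fderiv_const_mul (hF X), smul_apply, smul_eq_mul, nnnorm_mul,
    ENNReal.coe_mul, mul_pow]

/-- **The kinetic energy of the packaged state**:
`∫_{Λⁿ}|∇(Ψ_A/‖Ψ_A‖)|² = ∑_p |2πe(p)/L|² ‖a_pA‖² / ‖A‖²`. [cite: LSSY2005, App. A (A.6), (A.10)] -/
theorem lintegral_kineticDensity_sectorTrialState [DecidableEq ι] {L : ℝ} (hL : 0 < L)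
    {e : ι → Momentum} (he : Function.Injective e) {n : ℕ} {A : MvPolynomial ι ℂ}
    (hA : A.IsHomogeneous n) (hA0 : A ≠ 0) :
    ∫⁻ X in cellN n L, kineticDensity (sectorTrialState hL he hA hA0).ψ X =
      ENNReal.ofReal ((∑ p, ‖waveVector L (e p)‖ ^ 2 * (fockInner (pderiv p A) (pderiv p A)).re) /
        (fockInner A A).re) := by
  set N₂ : ℝ := (L ^ 3) ^ n * (fockInner A A).re with hN₂
  have hA2 : 0 < (fockInner A A).re := fockInner_self_re_pos hA0
  have hN₂0 : 0 < N₂ := mul_pos (by positivity) hA2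
  have hdiff : Differentiable ℝ (sectorWave L e A n) :=
    (contDiff_sectorWave L e A n 1).differentiable one_ne_zero
  have hψ : (sectorTrialState hL he hA hA0).ψ = fun X => (((Real.sqrt N₂)⁻¹ : ℝ) : ℂ) * sectorWave L e A n X := by
    funext X; rfl
  rw [hψ]
  simp only [kineticDensity_const_mul' _ hdiff]
  rw [lintegral_const_mul' _ _ (ENNReal.pow_ne_top ENNReal.coe_ne_top)]
  -- the constant
  have hc : ((‖(((Real.sqrt N₂)⁻¹ : ℝ) : ℂ)‖₊ : ℝ≥0∞) ^ 2) = ENNReal.ofReal N₂⁻¹ := by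
    rw [coe_nnnorm_sq_eq_ofReal, Complex.norm_real, norm_inv, Real.norm_of_nonneg (Real.sqrt_nonneg _),
      inv_pow, Real.sq_sqrt hN₂0.le]
  rw [hc]
  -- the kinetic integral in real form
  have hkin : ∫⁻ X in cellN n L, kineticDensity (sectorWave L e A n) X =
      ENNReal.ofReal ((L ^ 3) ^ n * ∑ p, ‖waveVector L (e p)‖ ^ 2 *
        (fockInner (pderiv p A) (pderiv p A)).re) := by
    have hpt : ∀ X : Config n, kineticDensity (sectorWave L e A n) X =
        ENNReal.ofReal (∑ i : Fin n, ∑ j : Fin 3,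
          ‖fderiv ℝ (sectorWave L e A n) X (Pi.single i (EuclideanSpace.single j (1 : ℝ)))‖ ^ 2) := by
      intro X
      unfold kineticDensity
      rw [ENNReal.ofReal_sum_of_nonneg fun i _ => Finset.sum_nonneg fun j _ => sq_nonneg _]
      refine Finset.sum_congr rfl fun i _ => ?_
      rw [ENNReal.ofReal_sum_of_nonneg fun j _ => sq_nonneg _]
      refine Finset.sum_congr rfl fun j _ => ?_
      rw [coe_nnnorm_sq_eq_ofReal]
    simp only [hpt]
    rw [← integral_cellN_kinetic_sectorWave hL he hA, ofReal_integral_eq_lintegral_ofReal]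
    · -- integrability: bounded continuous word sums, as in the kinetic identity
      refine integrable_finsetSum _ fun i _ => integrable_finsetSum _ fun j _ => ?_
      have hD : ∀ X : Config n, fderiv ℝ (sectorWave L e A n) X (Pi.single i (EuclideanSpace.single j (1 : ℝ))) =
          ∑ k : Fin n → ι, (amp A n k * (2 * Real.pi * Complex.I * (e (k i) j) / L)) *
            ∏ l, cellWave L (e (k l)) (X l) := by
        intro X
        rw [fderiv_sectorWave_single]
        refine Finset.sum_congr rfl fun k _ => ?_
        ring
      have hcont : Continuous fun X : Config n => ∑ k : Fin n → ι,
          (amp A n k * (2 * Real.pi * Complex.I * (e (k i) j) / L)) * ∏ l, cellWave L (e (k l)) (X l) := by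
        refine continuous_finsetSum _ fun k _ => continuous_const.mul ?_
        exact continuous_finsetProd _ fun l _ => (continuous_cellWave L _).comp (continuous_apply l)
      have hI := integrableOn_cellN_of_bounded L (F := fun X => ((‖∑ k : Fin n → ι,
        (amp A n k * (2 * Real.pi * Complex.I * (e (k i) j) / L)) * ∏ l, cellWave L (e (k l)) (X l)‖ ^ 2 : ℝ) : ℂ))
        (by fun_prop) (M := (∑ k : Fin n → ι, ‖amp A n k * (2 * Real.pi * Complex.I * (e (k i) j) / L)‖) ^ 2)
        (fun X => by
          rw [Complex.norm_real, Real.norm_of_nonneg (sq_nonneg _)]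
          refine pow_le_pow_left₀ (norm_nonneg _) ((norm_sum_le _ _).trans
            (Finset.sum_le_sum fun k _ => ?_)) 2
          rw [norm_mul, norm_prod_cellWave, mul_one])
      have hI' := hI.re
      simp only [← hD] at hI'
      exact hI'
    · exact Filter.Eventually.of_forall fun X => Finset.sum_nonneg fun i _ =>
        Finset.sum_nonneg fun j _ => sq_nonneg _
  rw [hkin, ← ENNReal.ofReal_mul (by positivity)]
  congr 1
  rw [hN₂]
  field_simp

/-- **The variational bound from a finite-mode sector.** For a non-zero homogeneous `A` of
degree `n` on finitely many modes with injective momentum labels `e`, the periodic ground-state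
energy of `n` bosons on the torus of side `L` is at most the energy of `Ψ_A/‖Ψ_A‖`:
`E^per(n, L) ≤ ∑_p |2πe(p)/L|² ‖a_pA‖²/‖A‖² + (L^{3n}‖A‖²)⁻¹ ∫_{Λⁿ} (∑_{i<j} v^per(xᵢ - xⱼ)) |Ψ_A|²`
(kinetic term in second-quantised form (A.10); the interaction term is left in configuration
space here). [cite: LSSY2005, App. A (A.9)–(A.10)] -/
theorem periodicGroundStateEnergy_le_sector [DecidableEq ι] (v : ℝ → ℝ≥0∞) {L : ℝ} (hL : 0 < L)
    {e : ι → Momentum} (he : Function.Injective e) {n : ℕ} {A : MvPolynomial ι ℂ}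
    (hA : A.IsHomogeneous n) (hA0 : A ≠ 0) :
    periodicGroundStateEnergy v n L ≤
      ENNReal.ofReal ((∑ p, ‖waveVector L (e p)‖ ^ 2 * (fockInner (pderiv p A) (pderiv p A)).re) /
          (fockInner A A).re) +
        ENNReal.ofReal (((L ^ 3) ^ n * (fockInner A A).re)⁻¹) *
          ∫⁻ X in cellN n L, periodicInteraction v L X * ((‖sectorWave L e A n X‖₊ : ℝ≥0∞) ^ 2) := by
  refine (iInf_le _ (sectorTrialState hL he hA hA0)).trans (le_of_eq ?_)
  set N₂ : ℝ := (L ^ 3) ^ n * (fockInner A A).re with hN₂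
  have hN₂0 : 0 < N₂ := mul_pos (by positivity) (fockInner_self_re_pos hA0)
  unfold periodicEnergy
  rw [lintegral_add_left]
  · rw [lintegral_kineticDensity_sectorTrialState hL he hA hA0]
    congr 1
    have hpt : ∀ X : Config n, periodicInteraction v L X *
        ((‖(sectorTrialState hL he hA hA0).ψ X‖₊ : ℝ≥0∞) ^ 2) =
        ENNReal.ofReal N₂⁻¹ * (periodicInteraction v L X * ((‖sectorWave L e A n X‖₊ : ℝ≥0∞) ^ 2)) := by
      intro X
      rw [sectorTrialState_ψ, nnnorm_mul, ENNReal.coe_mul, mul_pow, coe_nnnorm_sq_eq_ofReal,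
        Complex.norm_real, norm_inv, Real.norm_of_nonneg (Real.sqrt_nonneg _), inv_pow,
        Real.sq_sqrt hN₂0.le]
      ring
    simp only [hpt]
    rw [lintegral_const_mul' _ _ ENNReal.ofReal_ne_top]
  · exact Finset.measurable_sum _ fun i _ => Finset.measurable_sum _ fun k _ =>
      ((measurable_fderiv_apply_const ℝ _ _).nnnorm.coe_nnreal_ennreal).pow_const 2

end SectorWave

end Literature.MathematicalPhysics.QuantumManyBody.BoseGas

end
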